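import Literature.Computability.QuantumComplexity.CoreFamily
import Literature.Computability.QuantumComplexity.RevTableauUniform
import Literature.Computability.Complexity.CodeFP
import HarnessLib

/-!
# The AJL core circuit as an abstract gate list on `ℕ`-indexed wires

Topic `Literature/Computability/QuantumComplexity`; first step of the uniformity half of the
discharge of `ajl_jonesApproxProblem_mem_PromiseBQP` (AJL Thm. 1.2: "the algorithm … is polynomial
in `n, m, k`"; in the tree's model the circuit family `AJLCore.family` of `CoreFamily.lean` must be
printed by a polynomial-time machine, `QCircuitFamily.IsUniform`). Following Arora–Barak (§6.2,
proof of Thm. 6.15: the description is written gate by gate keeping counters) we first replace the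
dependently typed circuit (`Fin`-embeddings, well-formedness proofs) by an *abstract gate list*
`circA ℓ : List (RevDesc.AGate ℕ)` — gate symbols with `ℕ`-valued wires — defined by the same
recursion as `AJLCore.circ ℓ` (fan-out, copies, Hadamard tests, slots, letters, OAA words, Hadamard
sandwiches, phase kicks, reflections, compiled straight-line programs), with every block wire written
as `v % b` (the value of `RevSim.finOf b _ v`, definitionally) and every embedded wire as
`AJLCore.eblkVal`. Main results:

* `toAG`, `agE`: the abstraction of a placed gate and the code of an abstract gate;
  `encode_eq_agE`: `QGate.encode g = agE (toAG g)` for gates of the gate set;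
* the abstract constructors `phaseKickA`, `sandwichA`, `phaseSandwichA`, `reflectProgA`, `invA`,
  `oaaWordA`, `gopsA` (compiled flag programs through the abstract layout `layA`), `rotWordA`,
  `phaseWordA`, `letterA`, `slotA`, `wordA`, `copyA`, `stage1A`, `stage2A`, `circA`, each with the
  lemma identifying it with `List.map toAG` of the concrete constructor;
* **`sigmaEncode_circ`**: `sigmaEncode ⟨ℓ, anc ℓ, circ ℓ⟩ = boolPair (encodeNat ℓ)
  (boolPair (unaryEncodeNat (anc ℓ)) (rawE agE (circA ℓ)))`.

The polynomial-time computation of `circA` (typed `FP` algebra `CodeFP`) follows in the sequel files.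

## References

* D. Aharonov, V. Jones, Z. Landau, Algorithmica 55 (2009), Thm. 1.2 and §3.3 [AharonovJonesLandau2009].
* S. Arora, B. Barak, *Computational Complexity: A Modern Approach*, CUP 2009, §6.2 (uniform
  families), proof of Thm. 6.15 [AroraBarak2009].
-/

noncomputable section

namespace Literature.Computability.QuantumComplexity

open _root_.Computability Cryptography Complexity Complexity.CodeFP RevSim RevDesc BlockKit

namespace AJLCore

/-! ### Abstract gates -/

/-- Abstract gates: a Clifford+T symbol with `ℕ`-valued wires (`RevDesc.AGate ℕ`). [folklore] -/
abbrev AG : Type := AGate ℕ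

/-- The abstraction of a placed gate: its symbol and the values of its wires (oracle gates, absent
from the AJL circuits, are sent to a junk `H`). [folklore] -/
def toAG {N : ℕ} : QGate cliffordT N → AG
  | .gate g e => ⟨g, List.ofFn fun i => (e i : ℕ)⟩
  | .oracle _ e => ⟨.H, List.ofFn fun i => (e i : ℕ)⟩

/-- The code of an abstract gate: the layout of `QGate.encode` (tag bit `0`, the symbol code in
binary, the wires as a list of binary numerals). [cite: AroraBarak2009, §6.1] -/
def agE (a : AG) : List Bool := false :: boolPair (natE (symCode a.sym)) (listE natE a.wires)

/-- The symbol code is the `Encodable` code of the symbol. [folklore] -/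
theorem symCode_eq_encode (g : CliffordTOp) : symCode g = Encodable.encode g := by cases g <;> rfl

/-- **The code of a gate of the gate set is the code of its abstraction.** [folklore] -/
theorem encode_eq_agE {N : ℕ} (g : cliffordT.Op) (e : Fin (cliffordT.arity g) ↪ Fin N) :
    (QGate.gate g e : QGate cliffordT N).encode = agE (toAG (QGate.gate g e)) := by
  rw [QGate.encode, agE, toAG]
  simp only
  rw [symCode_eq_encode, listE_eq]
  rfl

/-- The code of an oracle-free circuit is the raw list of the codes of the abstract gates. [folklore] -/
theorem encode_eq_rawE {N : ℕ} (C : QCircuit cliffordT N) (hC : C.IsOracleFree) :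
    C.encode = rawE agE (C.gates.map toAG) := by
  rw [QCircuit.encode_eq_encList, rawE, List.map_map]
  congr 1
  refine List.map_congr_left fun g hg => ?_
  have h := hC g hg
  cases g with
  | gate g e => exact encode_eq_agE g e
  | oracle k e => exact absurd h (by simp [QGate.IsOracleFree])

/-- Abstraction of `H` on a wire. [folklore] -/
@[simp] theorem toAG_hOn {N : ℕ} (i : Fin N) : toAG (hOn i) = ⟨.H, [(i : ℕ)]⟩ := rfl
/-- Abstraction of `S` on a wire. [folklore] -/
@[simp] theorem toAG_sOn {N : ℕ} (i : Fin N) : toAG (sOn i) = ⟨.S, [(i : ℕ)]⟩ := rfl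
/-- Abstraction of `T` on a wire. [folklore] -/
@[simp] theorem toAG_tOn {N : ℕ} (i : Fin N) : toAG (tOn i) = ⟨.T, [(i : ℕ)]⟩ := rfl
/-- Abstraction of `CNOT` on two wires. [folklore] -/
@[simp] theorem toAG_cnotOn {N : ℕ} (i j : Fin N) (h : i ≠ j) : toAG (cnotOn i j h) = ⟨.CNOT, [(i : ℕ), (j : ℕ)]⟩ := rfl

/-- Re-indexing the wires of an abstract gate. [folklore] -/
def AGmap (f : ℕ → ℕ) (a : AG) : AG := ⟨a.sym, a.wires.map f⟩

/-- **Abstraction of a transported gate**: the wires are mapped by any `ℕ`-function agreeing with the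
embedding on values. [folklore] -/
theorem toAG_mapWiresGate {b W : ℕ} (ι : Fin b ↪ Fin W) (f : ℕ → ℕ) (hf : ∀ x : Fin b, f x = (ι x : ℕ)) (g : QGate cliffordT b) :
    toAG (mapWiresGate ι g) = AGmap f (toAG g) := by
  cases g with
  | gate g e => simp [mapWiresGate, toAG, AGmap, List.map_ofFn, Function.comp_def, hf]
  | oracle k e => simp [mapWiresGate, toAG, AGmap, List.map_ofFn, Function.comp_def, hf]

/-- The abstract inverse word: `invReps` verbatim copies of each gate, in reverse order. [cite: NielsenChuang2010, §4.2] -/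
def invA (gs : List AG) : List AG := gs.reverse.flatMap fun a => List.replicate (invReps a.sym) a

/-- Abstraction of the inverse word of a gate. [folklore] -/
theorem map_toAG_invWord {N : ℕ} (g : QGate cliffordT N) : g.invWord.map toAG = List.replicate (invReps (toAG g).sym) (toAG g) := by
  cases g with
  | gate g e => rw [QGate.invWord_gate, List.map_replicate]; rfl
  | oracle k e => rw [QGate.invWord_oracle]; rfl

/-- **Abstraction of the inverse circuit.** [folklore] -/
theorem map_toAG_inv {N : ℕ} (C : QCircuit cliffordT N) : C.inv.gates.map toAG = invA (C.gates.map toAG) := by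
  rw [QCircuit.gates_inv, invA, List.map_flatMap, ← List.map_reverse, List.flatMap_map]
  simp only [map_toAG_invWord]

/-- The abstract compiled word of a program of `ℕ`-indexed reversible gates. [cite: NielsenChuang2010, §4.3 Fig. 4.9] -/
def progA (ops : List (ClOp ℕ)) : List AG := ops.flatMap agates

/-- Abstraction of the compiled word of one well-formed gate. [folklore] -/
theorem map_toAG_compile_toRev {N : ℕ} (op : ClOp (Fin N)) (h : op.WF) :
    (op.toRev h).compile.map toAG = agates (op.map Fin.val) := by
  cases op with
  | not i => rfl
  | cnot i j => rfl
  | toffoli a b c => rfl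

/-- **Abstraction of a compiled program**: the `ℕ`-program of the wire values, compiled abstractly. [folklore] -/
theorem map_toAG_revCompile_toRevList {N : ℕ} : ∀ (ops : List (ClOp (Fin N))) (h : ∀ op ∈ ops, op.WF),
    (revCompile (toRevList ops h)).map toAG = progA (ops.map (ClOp.map Fin.val))
  | [], _ => rfl
  | op :: ops, h => by
    rw [toRevList, revCompile_cons, List.map_append, map_toAG_compile_toRev, map_toAG_revCompile_toRevList ops, List.map_cons, progA,
      progA, List.flatMap_cons]

/-- Programs re-indexed by `finOf` have wire values reduced modulo `N`. [folklore] -/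
theorem map_val_map_finOf {N : ℕ} (hN : 0 < N) (ops : List (ClOp ℕ)) :
    (ops.map (ClOp.map (finOf N hN))).map (ClOp.map Fin.val) = ops.map (ClOp.map fun v => v % N) := by
  rw [List.map_map]
  refine List.map_congr_left fun op _ => ?_
  cases op <;> rfl

/-! ### Abstract circuit constructors -/

/-- The `H` layer on a list of wires. [folklore] -/
def hLayerA (ws : List ℕ) : List AG := ws.map fun w => ⟨.H, [w]⟩

/-- The abstract phase-kick circuit: program, `S` layer, `Z` layer, reversed program. [cite: NielsenChuang2010, §3.2.5] -/
def phaseKickA (ops : List (ClOp ℕ)) (Fs Fz : List ℕ) : List AG :=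
  progA ops ++ Fs.map (fun f => ⟨.S, [f]⟩) ++ Fz.flatMap (fun f => [⟨.S, [f]⟩, ⟨.S, [f]⟩]) ++ progA ops.reverse

/-- The abstract Hadamard sandwich. [cite: BerryEtAl2014, §3] -/
def sandwichA (ws : List ℕ) (c t : ℕ) (ops : List (ClOp ℕ)) (Fs Fz : List ℕ) : List AG :=
  hLayerA ws ++ phaseKickA ops Fs Fz ++ [⟨.CNOT, [c, t]⟩] ++ (hLayerA ws).reverse

/-- The abstract diagonal sandwich. [cite: BerryEtAl2014, §3] -/
def phaseSandwichA (ws : List ℕ) (ops : List (ClOp ℕ)) (Fs Fz : List ℕ) : List AG :=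
  hLayerA ws ++ phaseKickA ops Fs Fz ++ (hLayerA ws).reverse

/-- The abstract reflection program. [cite: NielsenChuang2010, §4.3 Fig. 4.10] -/
def reflectProgA (a₀ : ℕ) (ls as : List ℕ) : List (ClOp ℕ) := (a₀ :: ls).map ClOp.not ++ clChain a₀ ls as

/-- The abstract reflection circuit. [cite: NielsenChuang2010, §6.1.2] -/
def reflectA (a₀ : ℕ) (ls as : List ℕ) : List AG := phaseKickA (reflectProgA a₀ ls as) [] [as.getLastD 0]

/-- The abstract OAA word `W R W⁻¹ R W`. [cite: BerryEtAl2014, Lemma 3.1] -/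
def oaaWordA (GW GR : List AG) : List AG := GW ++ GR ++ invA GW ++ GR ++ GW

/-- The abstract Hadamard test around a word. [cite: AharonovJonesLandau2009, §2.2] -/
def hadTestA (q : ℕ) (W : List AG) (im : Bool) : List AG :=
  [⟨.H, [q]⟩] ++ W ++ (if im then [⟨.S, [q]⟩, ⟨.S, [q]⟩, ⟨.S, [q]⟩] else []) ++ [⟨.H, [q]⟩]

section Generic

variable {N : ℕ}

/-- Abstraction of an `H` layer. [folklore] -/
theorem map_toAG_map_hOn (ws : List (Fin N)) : (ws.map hOn).map toAG = hLayerA (ws.map Fin.val) := by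
  simp [hLayerA, List.map_map, Function.comp_def]

/-- Abstraction of an `S` layer. [folklore] -/
theorem map_toAG_sLayer (Fs : List (Fin N)) : (sLayer Fs).gates.map toAG = (Fs.map Fin.val).map fun f => ⟨.S, [f]⟩ := by
  simp [sLayer, List.map_map, Function.comp_def]

/-- Abstraction of a `Z` layer. [folklore] -/
theorem map_toAG_zLayer (Fz : List (Fin N)) : (zLayer Fz).gates.map toAG = (Fz.map Fin.val).flatMap fun f => [⟨.S, [f]⟩, ⟨.S, [f]⟩] := by
  simp [zLayer, List.map_flatMap, List.flatMap_map]

/-- `ClOp.map` commutes with reversal of programs. [folklore] -/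
theorem map_reverse_clop (f : Fin N → ℕ) (ops : List (ClOp (Fin N))) : ops.reverse.map (ClOp.map f) = (ops.map (ClOp.map f)).reverse :=
  List.map_reverse

/-- **Abstraction of the phase-kick circuit.** [folklore] -/
theorem map_toAG_phaseKickCircuit (ops : List (ClOp (Fin N))) (h : ∀ op ∈ ops, op.WF) (Fs Fz : List (Fin N)) :
    (phaseKickCircuit ops h Fs Fz).gates.map toAG = phaseKickA (ops.map (ClOp.map Fin.val)) (Fs.map Fin.val) (Fz.map Fin.val) := by
  rw [phaseKickCircuit, phaseKickA]
  simp only [List.map_append]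
  rw [map_toAG_revCompile_toRevList, map_toAG_revCompile_toRevList, map_toAG_sLayer, map_toAG_zLayer, List.map_reverse]

/-- **Abstraction of the sandwich circuit.** [folklore] -/
theorem map_toAG_sandwichCircuit (ws : List (Fin N)) (c t : Fin N) (hct : c ≠ t) (ops : List (ClOp (Fin N))) (h : ∀ op ∈ ops, op.WF)
    (Fs Fz : List (Fin N)) :
    (sandwichCircuit ws c t hct ops h Fs Fz).gates.map toAG =
      sandwichA (ws.map Fin.val) c t (ops.map (ClOp.map Fin.val)) (Fs.map Fin.val) (Fz.map Fin.val) := by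
  rw [sandwichCircuit, sandwichA]
  simp only [QCircuit.gates_append, List.map_append, List.map_reverse, map_toAG_phaseKickCircuit, map_toAG_map_hOn]
  rfl

/-- **Abstraction of the diagonal sandwich circuit.** [folklore] -/
theorem map_toAG_phaseSandwichCircuit (ws : List (Fin N)) (ops : List (ClOp (Fin N))) (h : ∀ op ∈ ops, op.WF) (Fs Fz : List (Fin N)) :
    (phaseSandwichCircuit ws ops h Fs Fz).gates.map toAG =
      phaseSandwichA (ws.map Fin.val) (ops.map (ClOp.map Fin.val)) (Fs.map Fin.val) (Fz.map Fin.val) := by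
  rw [phaseSandwichCircuit, phaseSandwichA]
  simp only [QCircuit.gates_append, List.map_append, List.map_reverse, map_toAG_phaseKickCircuit, map_toAG_map_hOn]

/-- `clChain` commutes with re-indexing. [folklore] -/
theorem map_clChain {ι κ : Type*} (f : ι → κ) (a₀ : ι) : ∀ (ls as : List ι),
    (clChain a₀ ls as).map (ClOp.map f) = clChain (f a₀) (ls.map f) (as.map f)
  | [], as => by simp
  | l :: ls, [] => by simp [clChain]
  | l :: ls, a :: as => by rw [clChain, List.map_cons, List.map_cons, List.map_cons, clChain, map_clChain f a ls as]; rfl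

/-- Abstraction of the reflection program. [folklore] -/
theorem map_reflectProg (a₀ : Fin N) (ls as : List (Fin N)) :
    (reflectProg a₀ ls as).map (ClOp.map Fin.val) = reflectProgA a₀ (ls.map Fin.val) (as.map Fin.val) := by
  rw [reflectProg, reflectProgA, List.map_append, map_clChain, List.map_map, List.map_cons, List.map_cons, List.map_map]; rfl

/-- The last element through a map. [folklore] -/
theorem getLastD_map_val (as : List (Fin N)) (hne : as ≠ []) : (as.map Fin.val).getLastD 0 = ((as.getLast hne : Fin N) : ℕ) := by
  rw [List.getLastD_eq_getLast?, List.getLast?_eq_getLast_of_ne_nil (by simpa using hne), List.getLast_map]; rfl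

/-- **Abstraction of the reflection circuit.** [folklore] -/
theorem map_toAG_reflectCircuit (a₀ : Fin N) (ls as : List (Fin N)) (hne : as ≠ []) (hwf : ∀ op ∈ reflectProg a₀ ls as, op.WF) :
    (reflectCircuit a₀ ls as hne hwf).gates.map toAG = reflectA a₀ (ls.map Fin.val) (as.map Fin.val) := by
  rw [reflectCircuit, reflectA, map_toAG_phaseKickCircuit, map_reflectProg, getLastD_map_val as hne]; rfl

/-- **Abstraction of the OAA word.** [folklore] -/
theorem map_toAG_oaaWordCircuit (GW GR : QCircuit cliffordT N) :
    (oaaWordCircuit GW GR).gates.map toAG = oaaWordA (GW.gates.map toAG) (GR.gates.map toAG) := by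
  rw [oaaWordCircuit, oaaWordA]
  simp only [QCircuit.gates_append, List.map_append, map_toAG_inv]

/-- **Abstraction of the Hadamard test.** [folklore] -/
theorem map_toAG_hadTestCircuit (q : Fin N) (C : QCircuit cliffordT N) (im : Bool) :
    (hadTestCircuit q C im).gates.map toAG = hadTestA q (C.gates.map toAG) im := by
  rw [hadTestCircuit, hadTestA]
  cases im <;> simp [ctrlPhaseGates]

/-- The gates of a chain: the members' gates in reverse order. [folklore] -/
theorem gates_chainCircuit : ∀ L : List (QCircuit cliffordT N), (chainCircuit L).gates = L.reverse.flatMap QCircuit.gates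
  | [] => rfl
  | C :: Cs => by rw [chainCircuit, QCircuit.gates_append, gates_chainCircuit Cs, List.reverse_cons, List.flatMap_append]; simp

end Generic

/-! ### Block parameters and the abstract block -/

/-- **Block parameters**: strands `n`, slots `r`, averaging bits `k`, and the register / flag / scratch
counts `R, F, T` of the classical region. [folklore] -/
structure BP where
  /-- strands -/
  n : ℕ
  /-- slots -/
  r : ℕ
  /-- averaging bits -/
  k : ℕ
  /-- registers -/
  R : ℕ
  /-- flags -/
  F : ℕ
  /-- scratch blocks -/
  T : ℕ

namespace BP

variable (p : BP)

/-- Letters per slot, `2(n-1)`. [folklore] -/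
def A : ℕ := BlockKit.A p.n
/-- Classical word width `4k + 16`. [folklore] -/
def Wd : ℕ := SLP.thrWd p.k
/-- Scratch block size `3·Wd + 1`. [folklore] -/
def scr : ℕ := SLP.scrSize p.Wd
/-- Region size `R·Wd + F + T·scr`. [folklore] -/
def rs : ℕ := p.R * p.Wd + p.F + p.T * p.scr
/-- Offset of the dummy wire. [folklore] -/
def dOff : ℕ := dataOff p.n p.r
/-- Base of the register block. [folklore] -/
def rbv : ℕ := p.dOff + 2 + p.k + (p.k + p.rs)
/-- Block size. [folklore] -/
def b : ℕ := p.rbv + p.rs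
/-- Base of the flag block. [folklore] -/
def fb : ℕ := p.rbv + p.R * p.Wd
/-- Base of the scratch blocks. [folklore] -/
def sb : ℕ := p.fb + p.F
/-- Wire number `v` (the value of `RevSim.finOf b _ v`). [folklore] -/
def w (v : ℕ) : ℕ := v % p.b
/-- The Hadamard column / selector wire. [folklore] -/
def cr : ℕ := p.w (p.dOff + 1)
/-- The dummy wire. [folklore] -/
def d0 : ℕ := p.w p.dOff
/-- The test qubit. [folklore] -/
def q : ℕ := p.w 0
/-- The averaging wires. [folklore] -/
def as : List ℕ := (List.range p.k).map fun j => p.w (p.dOff + 2 + j)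
/-- The reflection helpers. [folklore] -/
def hs : List ℕ := (List.range (p.k + p.rs)).map fun j => p.w (p.dOff + 2 + p.k + j)
/-- The classical region. [folklore] -/
def region : List ℕ :=
  ((List.range (p.R * p.Wd)).map (fun i => p.rbv + i) ++ (List.range p.F).map (fun i => p.fb + i) ++
    (List.range (p.T * p.scr)).map (fun i => p.sb + i)).map p.w
/-- Local register wire `j < 6` of generator `i`. [folklore] -/
def e (i j : ℕ) : ℕ := p.w (1 + (2 * i + j))
/-- Table wire of slot `s`, letter index `x`. [folklore] -/
def tw (s x : ℕ) : ℕ := p.w (1 + 2 * (p.n + 1) + s * p.A + x)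

/-- **The abstract layout** of a gadget reading `as`, `cr`, then the wires `ins`. [folklore] -/
def layA (ins : List ℕ) : SLP.Layout where
  kIn := p.k + 1 + ins.length
  rb := p.rbv
  fb := p.fb
  sb := p.sb
  iw j := if j < p.k then p.w (p.dOff + 2 + j) else if j = p.k then p.cr else ins.getD (j - (p.k + 1)) p.cr

/-- The abstract compiled flag program of a gadget, from the compiler output `c = (program, result
flag, #registers, #flags)` (kept whole: its projections are never taken at the head of a term, so
that definitional unfolding never evaluates the compiler). [folklore] -/
def gopsA (ins : List ℕ) (c : List SLP.Instr × ℕ × ℕ × ℕ) : List (ClOp ℕ) := (SLP.compile (p.layA ins) (Wd := p.Wd) c.1).map (ClOp.map p.w)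

/-- The abstract flag wire of the result flag of a compiler output. [folklore] -/
def gflagA (c : List SLP.Instr × ℕ × ℕ × ℕ) : ℕ := p.w (p.fb + c.2.1)

/-- The compiled rotation program `(z, sgn)`. [folklore] -/
def progR (z sgn : ℤ) : List SLP.Instr × ℕ × ℕ × ℕ := (SLP.bRot p.k z sgn).compile p.Wd 0 0
/-- The compiled phase program `±`. [folklore] -/
def progP (pos : Bool) : List SLP.Instr × ℕ × ℕ × ℕ := (SLP.bPhase p.k pos).compile p.Wd 0 0

/-- The further inputs of a rotation gadget of generator `i`, slot `s`, letter index `x`. [folklore] -/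
def insRotA (i s x : ℕ) : List ℕ := [p.e i 2, p.q, p.tw s x, p.e i 0, p.e i 1, p.e i 3, p.e i 4, p.e i 5]
/-- The further inputs of the phase gadget. [folklore] -/
def insPhaseA (i s x : ℕ) : List ℕ := [p.d0, p.q, p.tw s x, p.e i 0, p.e i 1, p.e i 2, p.e i 3, p.e i 4, p.e i 5]

/-- The abstract reflection of the kit. [folklore] -/
def GRA : List AG := reflectA p.cr (p.as ++ p.region) p.hs

/-- The abstract rotation word of generator `i`, slot `s`, letter index `x`, from a compiler output `c`. [cite: AharonovJonesLandau2009, Claim 4.1] -/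
def rotWordC (i s x : ℕ) (c : List SLP.Instr × ℕ × ℕ × ℕ) : List AG :=
  oaaWordA (sandwichA (p.cr :: p.as) p.cr (p.e i 2) (p.gopsA (p.insRotA i s x) c) [] [p.gflagA c]) p.GRA

/-- The abstract phase word from a compiler output `c`. [cite: AharonovJonesLandau2009, Claim 4.1] -/
def phaseWordC (i s x : ℕ) (c : List SLP.Instr × ℕ × ℕ × ℕ) : List AG :=
  oaaWordA (phaseSandwichA (p.cr :: p.as) (p.gopsA (p.insPhaseA i s x) c) [p.cr] [p.gflagA c]) p.GRA

/-- The abstract rotation word `(z, sgn)`. [cite: AharonovJonesLandau2009, Claim 4.1] -/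
def rotWordA (i s x : ℕ) (z sgn : ℤ) : List AG := p.rotWordC i s x (p.progR z sgn)

/-- The abstract phase word `±`. [cite: AharonovJonesLandau2009, Claim 4.1] -/
def phaseWordA (i s x : ℕ) (pos : Bool) : List AG := p.phaseWordC i s x (p.progP pos)

/-- The abstract letter circuit of generator `i`, sign `σ`, in slot `s`. [cite: AharonovJonesLandau2009, Claim 4.1] -/
def letterA (s i : ℕ) (σ : Bool) : List AG :=
  p.rotWordA i s (2 * i + σ.toNat) 2 (-1) ++ p.rotWordA i s (2 * i + σ.toNat) 3 (-1) ++ p.phaseWordA i s (2 * i + σ.toNat) σ ++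
    p.rotWordA i s (2 * i + σ.toNat) 3 1 ++ p.rotWordA i s (2 * i + σ.toNat) 2 1

/-- All letters `(i, ±)` as numbers. [folklore] -/
def lettersA (n : ℕ) : List (ℕ × Bool) := (List.range (n - 1)).flatMap fun i => [(i, false), (i, true)]

/-- The abstract slot. [cite: AharonovJonesLandau2009, §3.2] -/
def slotA (s : ℕ) : List AG := (lettersA p.n).reverse.flatMap fun ib => p.letterA s ib.1 ib.2

/-- The abstract word. [cite: AharonovJonesLandau2009, §3.2] -/
def wordA : List AG := (List.range p.r).reverse.flatMap p.slotA

/-- The abstract copy (one Hadamard test). [cite: AharonovJonesLandau2009, §3.3] -/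
def copyA (im : Bool) : List AG := hadTestA p.q p.wordA im

end BP

/-! ### The concrete block is the abstract block -/

section Block

variable (n r k : ℕ)

/-- The parameters of the concrete block. [folklore] -/
def bpOf : BP := ⟨n, r, k, kitR k, kitF k, kitT k⟩

/-- The block size agrees. [folklore] -/
theorem bpOf_b : (bpOf n r k).b = bsize n r k := rfl

/-- Values of block wires. [folklore] -/
theorem wire_val_eq (v : ℕ) : (wire n r k v : ℕ) = (bpOf n r k).w v := rfl

/-- The averaging wires. [folklore] -/
theorem kit_as_val : (kit n r k).as.map Fin.val = (bpOf n r k).as := by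
  rw [kit_as, List.map_map]; rfl

/-- The helpers. [folklore] -/
theorem kit_hs_val : (kit n r k).hs.map Fin.val = (bpOf n r k).hs := by
  rw [kit_hs, List.map_map]; rfl

/-- The region. [folklore] -/
theorem kit_region_val : (kit n r k).region.map Fin.val = (bpOf n r k).region := by
  rw [GadgetKit.region, layoutRegion, List.map_map, BP.region]; rfl

/-- **The layout of the kit is the abstract layout.** [folklore] -/
theorem useLayout_eq (ins : List (Fin (bsize n r k))) : (kit n r k).useLayout ins = (bpOf n r k).layA (ins.map Fin.val) := by
  have hlen : (kit n r k).as.length = k := by rw [kit_as, List.length_map, List.length_range]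
  simp only [GadgetKit.useLayout, BP.layA, List.length_map]
  congr 1
  funext j
  by_cases hj : j < k
  · rw [dif_pos (by rw [hlen]; exact hj), if_pos (show j < (bpOf n r k).k from hj)]
    simp only [kit_as, List.getElem_map, List.getElem_range]; rfl
  · rw [dif_neg (by rw [hlen]; exact hj), if_neg (show ¬ j < (bpOf n r k).k from hj)]
    by_cases hjk : j = k
    · rw [if_pos (show j = (kit n r k).k from hjk), if_pos (show j = (bpOf n r k).k from hjk)]; rfl
    · rw [if_neg (show ¬ j = (kit n r k).k from hjk), if_neg (show ¬ j = (bpOf n r k).k from hjk),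
        show (bpOf n r k).cr = Fin.val (kit n r k).cr from rfl, List.getD_map]; rfl

/-- Abstraction of a gadget's flag program. [folklore] -/
theorem map_val_gadgetOps (ins : List (Fin (bsize n r k))) (b : SLP.BExpr) :
    (gadgetOps (bsize_pos n r k) ((kit n r k).useLayout ins) b (Wd := SLP.thrWd k)).map (ClOp.map Fin.val) =
      (bpOf n r k).gopsA (ins.map Fin.val) (b.compile (SLP.thrWd k) 0 0) := by
  rw [gadgetOps, map_val_map_finOf, useLayout_eq]; rfl

/-- Abstraction of a gadget's flag wire. [folklore] -/
theorem val_gadgetFlag (ins : List (Fin (bsize n r k))) (b : SLP.BExpr) :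
    (gadgetFlag (bsize_pos n r k) ((kit n r k).useLayout ins) b (Wd := SLP.thrWd k) : ℕ) = (bpOf n r k).gflagA (b.compile (SLP.thrWd k) 0 0) := rfl

end Block

section Copy

variable {n r k : ℕ}

/-- The kit of the geometry (definitional). [folklore] -/
theorem geom_kit : (BlockGeom.geom n r k).kit = kit n r k := rfl

/-- The Hadamard wires of the geometry's kit. [folklore] -/
theorem geom_had_val : ((BlockGeom.geom n r k).kit.cr :: (BlockGeom.geom n r k).kit.as).map Fin.val = (bpOf n r k).cr :: (bpOf n r k).as := by
  rw [List.map_cons]; exact congrArg _ (kit_as_val n r k)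

/-- Abstraction of the kit's reflection. [folklore] -/
theorem map_toAG_reflect_kit (hne : (BlockGeom.geom n r k).kit.hs ≠ [])
    (hwf : ∀ op ∈ reflectProg (BlockGeom.geom n r k).kit.cr ((BlockGeom.geom n r k).kit.as ++ (BlockGeom.geom n r k).kit.region) (BlockGeom.geom n r k).kit.hs, op.WF) :
    (reflectCircuit (BlockGeom.geom n r k).kit.cr ((BlockGeom.geom n r k).kit.as ++ (BlockGeom.geom n r k).kit.region) (BlockGeom.geom n r k).kit.hs hne hwf).gates.map toAG =
      (bpOf n r k).GRA := by
  rw [map_toAG_reflectCircuit, List.map_append]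
  change reflectA _ ((kit n r k).as.map Fin.val ++ (kit n r k).region.map Fin.val) ((kit n r k).hs.map Fin.val) = _
  rw [kit_as_val, kit_region_val, kit_hs_val]; rfl

variable (hk : (BlockGeom.geom n r k).kit.OK) {s : Fin r} {pp : Fin (n - 1) × Bool}
  (hL : (BlockGeom.geom n r k).kit.LetterOK ((BlockGeom.geom n r k).eOf pp.1) (BlockGeom.geom n r k).q ((BlockGeom.geom n r k).tw s pp))

/-- The rotation inputs. [folklore] -/
theorem insRot_val : (GadgetKit.insRot ((BlockGeom.geom n r k).eOf pp.1) (BlockGeom.geom n r k).q ((BlockGeom.geom n r k).tw s pp)).map Fin.val =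
    (bpOf n r k).insRotA pp.1 s (BlockGeom.idx pp) := rfl

/-- The phase inputs. [folklore] -/
theorem insPhase_val : (GadgetKit.insPhase (BlockGeom.geom n r k).kit ((BlockGeom.geom n r k).eOf pp.1) (BlockGeom.geom n r k).q ((BlockGeom.geom n r k).tw s pp)).map Fin.val =
    (bpOf n r k).insPhaseA pp.1 s (BlockGeom.idx pp) := rfl

/-- **Abstraction of a rotation word.** [folklore] -/
theorem map_toAG_rotWord {z sgn : ℤ} (hz : z = 2 ∨ z = 3) (hs : sgn = 1 ∨ sgn = -1) :
    (GadgetKit.rotWord hk hL hz hs).gates.map toAG = (bpOf n r k).rotWordA pp.1 s (BlockGeom.idx pp) z sgn := by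
  have e1 : ((BlockGeom.geom n r k).kit.rotOps ((BlockGeom.geom n r k).eOf pp.1) (BlockGeom.geom n r k).q ((BlockGeom.geom n r k).tw s pp) z sgn).map (ClOp.map Fin.val) =
      (bpOf n r k).gopsA ((bpOf n r k).insRotA pp.1 s (BlockGeom.idx pp)) ((bpOf n r k).progR z sgn) :=
    map_val_gadgetOps n r k (GadgetKit.insRot ((BlockGeom.geom n r k).eOf pp.1) (BlockGeom.geom n r k).q ((BlockGeom.geom n r k).tw s pp)) (SLP.bRot k z sgn)
  have e2 : (((BlockGeom.geom n r k).kit.rotFlag ((BlockGeom.geom n r k).eOf pp.1) (BlockGeom.geom n r k).q ((BlockGeom.geom n r k).tw s pp) z sgn : Fin _) : ℕ) =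
      (bpOf n r k).gflagA ((bpOf n r k).progR z sgn) := val_gadgetFlag n r k (GadgetKit.insRot ((BlockGeom.geom n r k).eOf pp.1) (BlockGeom.geom n r k).q ((BlockGeom.geom n r k).tw s pp)) (SLP.bRot k z sgn)
  have e3 : (((BlockGeom.geom n r k).kit.cr : Fin _) : ℕ) = (bpOf n r k).cr := rfl
  have e4 : (((BlockGeom.geom n r k).eOf pp.1 2 : Fin _) : ℕ) = (bpOf n r k).e pp.1 2 := rfl
  rw [GadgetKit.rotWord, map_toAG_oaaWordCircuit, map_toAG_sandwichCircuit, map_toAG_reflect_kit, BP.rotWordA, BP.rotWordC, geom_had_val, e1]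
  simp only [List.map_cons, List.map_nil, e2, e3, e4]

/-- **Abstraction of a phase word.** [folklore] -/
theorem map_toAG_phaseWord (pos : Bool) :
    (GadgetKit.phaseWord hk hL pos).gates.map toAG = (bpOf n r k).phaseWordA pp.1 s (BlockGeom.idx pp) pos := by
  have e1 : ((BlockGeom.geom n r k).kit.phaseOps ((BlockGeom.geom n r k).eOf pp.1) (BlockGeom.geom n r k).q ((BlockGeom.geom n r k).tw s pp) pos).map (ClOp.map Fin.val) =
      (bpOf n r k).gopsA ((bpOf n r k).insPhaseA pp.1 s (BlockGeom.idx pp)) ((bpOf n r k).progP pos) :=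
    map_val_gadgetOps n r k (GadgetKit.insPhase (BlockGeom.geom n r k).kit ((BlockGeom.geom n r k).eOf pp.1) (BlockGeom.geom n r k).q ((BlockGeom.geom n r k).tw s pp)) (SLP.bPhase k pos)
  have e2 : (((BlockGeom.geom n r k).kit.phaseFlag ((BlockGeom.geom n r k).eOf pp.1) (BlockGeom.geom n r k).q ((BlockGeom.geom n r k).tw s pp) pos : Fin _) : ℕ) =
      (bpOf n r k).gflagA ((bpOf n r k).progP pos) := val_gadgetFlag n r k (GadgetKit.insPhase (BlockGeom.geom n r k).kit ((BlockGeom.geom n r k).eOf pp.1) (BlockGeom.geom n r k).q ((BlockGeom.geom n r k).tw s pp)) (SLP.bPhase k pos)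
  have e3 : (((BlockGeom.geom n r k).kit.cr : Fin _) : ℕ) = (bpOf n r k).cr := rfl
  rw [GadgetKit.phaseWord, map_toAG_oaaWordCircuit, map_toAG_phaseSandwichCircuit, map_toAG_reflect_kit, BP.phaseWordA, BP.phaseWordC, geom_had_val, e1]
  simp only [List.map_cons, List.map_nil, e2, e3]

/-- **Abstraction of a letter circuit.** [folklore] -/
theorem map_toAG_letterCircuit (pos : Bool) :
    (GadgetKit.letterCircuit hk hL pos).gates.map toAG =
      (bpOf n r k).rotWordA pp.1 s (BlockGeom.idx pp) 2 (-1) ++ (bpOf n r k).rotWordA pp.1 s (BlockGeom.idx pp) 3 (-1) ++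
        (bpOf n r k).phaseWordA pp.1 s (BlockGeom.idx pp) pos ++ (bpOf n r k).rotWordA pp.1 s (BlockGeom.idx pp) 3 1 ++
          (bpOf n r k).rotWordA pp.1 s (BlockGeom.idx pp) 2 1 := by
  rw [GadgetKit.letterCircuit]
  simp only [QCircuit.gates_append, List.map_append, map_toAG_rotWord, map_toAG_phaseWord]

variable {hk}
variable (hG : (BlockGeom.geom n r k).OK)

/-- The letters as numbers. [folklore] -/
theorem map_allLetters (n : ℕ) : (allLetters n).map (fun pp => ((pp.1 : ℕ), pp.2)) = BP.lettersA n := by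
  rw [allLetters, BP.lettersA, List.map_flatMap]
  rw [show List.range (n - 1) = (List.finRange (n - 1)).map Fin.val from List.map_coe_finRange_eq_range.symm, List.flatMap_map]
  rfl

/-- **Abstraction of a slot.** [folklore] -/
theorem map_toAG_slotCircuit (s : Fin r) : (WordGeom.slotCircuit hG s).gates.map toAG = (bpOf n r k).slotA s := by
  rw [WordGeom.slotCircuit, gates_chainCircuit, List.map_flatMap, BP.slotA, ← map_allLetters, ← List.map_reverse, ← List.map_reverse, List.flatMap_map,
    List.flatMap_map]
  refine List.flatMap_congr fun pp _ => ?_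
  rw [map_toAG_letterCircuit, BP.letterA]
  rfl

/-- **Abstraction of the word circuit.** [folklore] -/
theorem map_toAG_wordCircuit : (WordGeom.wordCircuit hG).gates.map toAG = (bpOf n r k).wordA := by
  rw [WordGeom.wordCircuit, gates_chainCircuit, List.map_flatMap, BP.wordA, ← List.map_reverse, List.flatMap_map,
    show List.range (bpOf n r k).r = (List.finRange r).map Fin.val from List.map_coe_finRange_eq_range.symm, ← List.map_reverse, List.flatMap_map]
  exact List.flatMap_congr fun s _ => map_toAG_slotCircuit hG s

/-- **Abstraction of a copy.** [folklore] -/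
theorem map_toAG_copyCircuit (im : Bool) : (WordGeom.copyCircuit hG im).gates.map toAG = (bpOf n r k).copyA im := by
  rw [WordGeom.copyCircuit, map_toAG_hadTestCircuit, map_toAG_wordCircuit]; rfl

end Copy

/-! ### The whole circuit -/

section Whole

variable (ℓ : ℕ)

/-- The block parameters at input length `ℓ`. [folklore] -/
def pOf : BP := bpOf (nOf ℓ) (rOf ℓ) (kOf ℓ)

/-- The abstract fan-out pairs into block `j`. [folklore] -/
def blockPairsA (j : ℕ) : List (ℕ × ℕ) :=
  ((List.range (rOf ℓ)).flatMap fun s => (BP.lettersA (nOf ℓ)).map fun ib =>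
      (s * A (nOf ℓ) + (2 * ib.1 + ib.2.toNat), eblkVal ℓ j ((pOf ℓ).tw s (2 * ib.1 + ib.2.toNat)))) ++
    (List.range (2 * (nOf ℓ + 1))).map fun i => (rOf ℓ * A (nOf ℓ) + i, eblkVal ℓ j ((pOf ℓ).w (1 + i)))

/-- All abstract fan-out pairs. [folklore] -/
def pairsA : List (ℕ × ℕ) := if Fits ℓ then (List.range (mOf ℓ)).flatMap (blockPairsA ℓ) else []

/-- The abstract fan-out stage. [folklore] -/
def stage1A : List AG := (pairsA ℓ).map fun pr => ⟨.CNOT, [pr.1, pr.2]⟩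

/-- The abstract copies stage. [cite: AharonovJonesLandau2009, §3.3] -/
def stage2A : List AG :=
  (List.range (mOf ℓ)).reverse.flatMap fun j => ((pOf ℓ).copyA (decide (KOf ℓ ≤ j))).map (AGmap (eblkVal ℓ j))

/-- **The abstract AJL core circuit.** [cite: AharonovJonesLandau2009, §3.3] -/
def circA : List AG := stage1A ℓ ++ stage2A ℓ

/-- Abstraction of a fan-out. [folklore] -/
theorem map_toAG_revCompile_fanoutOps {W : ℕ} : ∀ (prs : List (Fin W × Fin W)) (h : ∀ pr ∈ prs, pr.1 ≠ pr.2),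
    (revCompile (fanoutOps prs h)).map toAG = prs.map fun pr => ⟨.CNOT, [(pr.1 : ℕ), (pr.2 : ℕ)]⟩
  | [], _ => rfl
  | pr :: prs, h => by
    rw [fanoutOps_cons, revCompile_cons, List.map_append, map_toAG_revCompile_fanoutOps prs, List.map_cons]; rfl

/-- The fan-out pairs into a block, as numbers. [folklore] -/
theorem blockPairs_val (h : Fits ℓ) (j : Fin (mOf ℓ)) :
    (blockPairs ℓ h j).map (fun pr => ((pr.1 : ℕ), (pr.2 : ℕ))) = blockPairsA ℓ j := by
  rw [blockPairs, blockPairsA, List.map_append, List.map_flatMap, List.map_map, ← map_allLetters,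
    show List.range (rOf ℓ) = (List.finRange (rOf ℓ)).map Fin.val from List.map_coe_finRange_eq_range.symm,
    show List.range (2 * (nOf ℓ + 1)) = (List.finRange (2 * (nOf ℓ + 1))).map Fin.val from List.map_coe_finRange_eq_range.symm,
    List.flatMap_map, List.map_map]
  congr 1
  refine List.flatMap_congr fun s _ => ?_
  rw [List.map_map, List.map_map]
  rfl

/-- The fan-out pairs, as numbers. [folklore] -/
theorem pairs_val : (pairs ℓ).map (fun pr => ((pr.1 : ℕ), (pr.2 : ℕ))) = pairsA ℓ := by
  unfold pairs pairsA
  split_ifs with h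
  · rw [List.map_flatMap, show List.range (mOf ℓ) = (List.finRange (mOf ℓ)).map Fin.val from List.map_coe_finRange_eq_range.symm, List.flatMap_map]
    exact List.flatMap_congr fun j _ => blockPairs_val ℓ h j
  · rfl

/-- **Abstraction of the fan-out stage.** [folklore] -/
theorem map_toAG_stage1 : (stage1 ℓ).map toAG = stage1A ℓ := by
  rw [stage1, map_toAG_revCompile_fanoutOps, stage1A, ← pairs_val, List.map_map]; rfl

/-- **Abstraction of the copies stage.** [folklore] -/
theorem map_toAG_stage2 : (stage2 ℓ).gates.map toAG = stage2A ℓ := by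
  rw [stage2, copiesCircuit, stage2A, List.map_flatMap, show List.range (mOf ℓ) = (List.finRange (mOf ℓ)).map Fin.val from List.map_coe_finRange_eq_range.symm,
    ← List.map_reverse, List.flatMap_map]
  refine List.flatMap_congr fun j _ => ?_
  rw [gates_mapWires, List.map_map]
  have hf : ∀ x : Fin (bOf ℓ), eblkVal ℓ j x = (Eblk ℓ j x : ℕ) := fun x => rfl
  have e : (WordGeom.copyCircuit (Gb_ok ℓ) (ty ℓ j)).gates.map toAG = (pOf ℓ).copyA (decide (KOf ℓ ≤ j)) := map_toAG_copyCircuit (Gb_ok ℓ) (ty ℓ j)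
  rw [show (toAG ∘ mapWiresGate (Eblk ℓ j)) = AGmap (eblkVal ℓ j) ∘ toAG from funext fun g => toAG_mapWiresGate _ _ hf g, ← List.map_map, e]

/-- **Abstraction of the core circuit.** [folklore] -/
theorem map_toAG_circ : (circ ℓ).gates.map toAG = circA ℓ := by
  rw [circA, ← map_toAG_stage1, ← map_toAG_stage2, ← List.map_append]; rfl

/-- **The description of the core circuit through the abstract gate list.** [cite: AroraBarak2009, §6.1–6.2] -/
theorem sigmaEncode_circ :
    QCircuit.sigmaEncode (G := cliffordT) ⟨ℓ, anc ℓ, circ ℓ⟩ = boolPair (encodeNat ℓ) (boolPair (unaryEncodeNat (anc ℓ)) (rawE agE (circA ℓ))) := by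
  rw [QCircuit.sigmaEncode_eq, encode_eq_rawE (circ ℓ) (circ_isOracleFree ℓ), map_toAG_circ]

end Whole

end AJLCore

end Literature.Computability.QuantumComplexity

end
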